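/-
COR-CM (cell pub-hodgecm2) — ¬hJ RUSH, HEAD-A at a `PhiMu` character ((P-N.d), LEAD decision pub-hodgecm2/INBOX l.19195; planner (N5)∕N298),
pen nothj-p5 (prover-pub-hodgecm2-nothj-p5-g0-0).  THEOREMS ONLY (kernel lane); no `def`, no `sorry`; nothing landed is edited or restated.
FRAMING: HC_CM is NOT proved; «Δ2 BRIDGE CLOSED» is NOT claimed; nothing here asserts hJ, hJ₀ or their negations; `J₁` is a HYPOTHESIS.
-/
import Summits.HodgeConjecture.CorCM.D2Bridge.OrientationT2NotHJTwoSocketCore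
import Summits.HodgeConjecture.CorCM.D2Bridge.OrientationT2NotHJPhiMuPinSocket
import Summits.HodgeConjecture.CorCM.D2Bridge.OrientationT2NotHJPhiMuIota1Socket
import HarnessLib

set_option autoImplicit false

/-!
# ¬hJ₀, HEAD-A AT A `PhiMu` CHARACTER: multiplicity one + `Ω(μ) ≠ 0` + `J₁` at instance `ι₁` ⊢ `False`

(P-N.d) of the ¬hJ lane (LEAD decision, pub-hodgecm2/INBOX l.19195): the two-socket core ✔ `NotHJ.false_of_twoSockets`
(`OrientationT2NotHJTwoSocketCore`, nothj-p4) needs the two (4.3)-images typed OPPOSITELY, not a conjugate-typed tail.  At a weight-one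
conjugate-symplectic `μ` WITH `ι₁ ∈ Φ_μ` — e.g. `μ := muOfInvType ι₁ Φ` (`Φ_μ = Φ^{*ι₁} ∋ ι₁`), the character of the DISPLAYED `hHom` row of
✔ `ClosedPrintedMuConjHomNeZero.lean` — the hypothetical `J₁` @ `ι₁` feeds `(1,0)`-classes (socket `OrientationT2NotHJPhiMuIota1Socket`) and the tree's
pin @ `ῑ₁` feeds `(0,1)`-classes (socket `OrientationT2NotHJPhiMuPinSocket`) over the SAME `ι₁`-presented rest, `τ' := ι₁`; DISPLAYED: multiplicity
one of the tower `hss ∕ hmf` (the M2 interface, ✔ `multOne_of_equivariant_directSum`) and `hPN : Nontrivial Ω(μ)` (= the `hHom` row's non-zero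
`Hom_E(A_K, A_μ)_ℚ` read into the colimit).  NO split line, NO `hsign`, NO purity row, NO `hLiuC`, NO κ.  HC_CM is NOT proved.

* `false_of_componentAlbanese_iota1_of_multOne_of_nontrivial_phiMu` — the head.
[Liu2021] Prop. 4.13, Def. 4.11, App. D Lem. D.1 (3), Thm. 4.18 with proof map (4.2)∕(4.3) (FJcycle.tex l. 2247–2253).
-/

noncomputable section

open scoped TensorProduct DirectSum

namespace Summit.HodgeConjecture.CorCM.D2Bridge.NotHJ

open NumberField
open HodgeCM HodgeCM.Model HodgeCM.Model.TowerCarrier HodgeCM.Model.TowerLevel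
open HodgeCM.Literature.Theta HodgeCM.Literature.Theta.LiuAlbaneseModuleDatum
open HodgeCM.Literature.Theta.LiuAlbaneseModuleDatum.D2Bridge (HcmPieces hcm_of_pieces)
open Literature.AlgebraicGeometry.Motives (CMType)
open Literature.AlgebraicGeometry.HodgeTheory Literature.NumberTheory.Automorphic.PicardCM
open Literature.AlgebraicGeometry.ShimuraVarieties.UnitaryCanonicalModel
open Literature.NumberTheory.Automorphic
open Literature.NumberTheory.Automorphic.Liu2021 Literature.NumberTheory.Automorphic.Liu2021.AppendixC
open Literature.NumberTheory.Automorphic.Liu2021.AppendixC.RestOne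
open Literature.NumberTheory.Transcendental (Arapura2012_Cor_15_4_6)
open Literature.RepresentationTheory
open Summit.HodgeConjecture.CorCM.HComp


section HeadPhiMu

variable {L : HodgeCM.CMField} {ι₁ : (L : Type) →+* ℂ}

set_option synthInstance.maxHeartbeats 400000 in
set_option maxHeartbeats 6400000 in
/-- **HEAD-A″ (generic face, `PhiMu` character).**  As `false_of_componentAlbanese_iota1_of_multOne_of_nontrivial`, but at a weight-one
conjugate-symplectic `μ` WITH `ι₁ ∈ Φ_μ` (e.g. `μ = muOfInvType ι₁ Φ`, `Φ_μ = Φ^{*ι₁} ∋ ι₁` — the character of the DISPLAYED `hHom` row of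
✔ `ClosedPrintedMuConjHomNeZero.lean`), `τ' := ι₁`, NO split line, NO `hsign`: the hypothetical `J₁` at instance `ι₁` feeds (1,0)-classes
(✔ `tau_mem_cmType_of_isReflexOfType`), the tree's pin ✔ `componentAlbanesePinTotal` at instance `ῑ₁` feeds (0,1)-classes
(✔ `tau_notMem_cmType_of_isReflexOfType_starRingEnd_comp` — the audit's parity statement), over the SAME `ι₁`-presented rest; DISPLAYED
`hss ∕ hmf` (multiplicity one) + `hPN : Nontrivial Ω(μ)` (the `hHom` row's class).  ⊢ `False` by `false_of_twoSockets`.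
HC_CM is NOT proved; `J₁` is NOT claimed to exist.
[cite: Liu2021, Prop. 4.13 (FJcycle.tex l. 2113–2119), Def. 4.11, App. D Lem. D.1 (3), Thm. 4.18 (l. 2232–2245) with proof map (4.2)∕(4.3) (l. 2247–2253)]
[cite: VoisinHodgeI2002, §6.1.3 Cor. 6.14] [cite: Shimura1998, §8.3 Prop. 28] -/
theorem false_of_componentAlbanese_iota1_of_multOne_of_nontrivial_phiMu
    {hHD : exists_isReal_hodgeModel} {hI : hodgePQ_independent_of_hodgeModel}
    {h₁ : BallQuotientUniformised} {h₃ : CMAbelianVarietyRealised} {hA : Arapura2012_Cor_15_4_6}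
    [IsGalois ℚ (L : Type)] (hU7 : heckeTranslate_definedOver) (V : HodgeCM.HermSpace3 L ι₁) (h : exists_recordSystem)
    (h4 : 4 ≤ Module.finrank ℚ L) (Φ : CMType (pkgF L))
    (iso : ∀ (F : Summit.HodgeConjecture.CorCM.CMField) (ι : F →+* ℂ) (_ : Summit.HodgeConjecture.CorCM.HermSpace3 F ι)
      (_ : CMType F), ℕ → Prop)
    (U : UniformOmega (Model.sec42DataOf h iso (pkgF L) ι₁ (pkgV V) Φ))
    {μ : Literature.NumberTheory.Automorphic.IdeleClassGroup L →ₜ* Circle} (hμ : IdeleClassGroup.IsConjugateSymplectic (L : Type) μ)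
    (hw : IdeleClassGroup.HasWeight (L : Type) μ 1) (Car : Def45.Carriers (L : Type) μ)
    (hΦμ : ι₁ ∈ hμ.cmType.1) (Dμ : ObjOne (AlgHom.id ℚ (L : Type)) ι₁ hμ hw Car)
    -- (i) multiplicity one of the tower `H` as a `ℂ[U(V)(𝔸_f)]`-module — DISPLAYED (M2 interface)
    (hss : IsSemisimpleModule (MonoidAlgebra ℂ ↥V.adelicFin) (Tower hHD hI (ballQuotientUniformisedDatum_of h₁) h₃ hA V))
    (hmf : ∀ S S' : Submodule (MonoidAlgebra ℂ ↥V.adelicFin) (Tower hHD hI (ballQuotientUniformisedDatum_of h₁) h₃ hA V),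
      IsAtom S → IsAtom S' → Nonempty (S ≃ₗ[MonoidAlgebra ℂ ↥V.adelicFin] S') → S = S')
    -- (ii) (P-N) non-vanishing of `Ω(μ) = Hom_E(A_∞, A_μ)_ℚ` — DISPLAYED (the `hHom` class)
    (hPN : Nontrivial (toThm418Data _ (U.rest (restTailOne (AlgHom.id ℚ (L : Type)) ι₁ hμ hw Car
          ((Model.sec42DataOf_heckeTranslates hU7 h (pkgV V) Φ iso h4).rhoΩOne (AlgHom.id ℚ (L : Type)) ι₁ hμ hw Car)))).Ω)
    -- THE HYPOTHESIS: a component-Albanese record for `C` at instance `ι₁` (NOT in the tree), with its level law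
    [inst : Algebra (L : Type) ℂ] (hinst : ∀ x : (L : Type), algebraMap (L : Type) ℂ x = ι₁ x)
    (J₁ : ComponentAlbanese hHD hI (ballQuotientUniformisedDatum_of h₁) h₃ hA V h Φ (Model.sec42DataOf h iso (pkgF L) ι₁ (pkgV V) Φ) (Model.sec42DataOf_heckeTranslates hU7 h (pkgV V) Φ iso h4))
    (hΓ₁ : ∀ K₁ : C5.SmallLevel (Model.sec42DataOf h iso (pkgF L) ι₁ (pkgV V) Φ).S.K₀,
      ((J₁.Γof K₁).K : Subgroup ↥V.adelicFin) = (K₁.1 : Subgroup (Model.sec42DataOf h iso (pkgF L) ι₁ (pkgV V) Φ).G)) :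
    False := by
  obtain ⟨M, jH, hjHinj, hjH, hpieces⟩ :=
    pinSocket_phiMu (hHD := hHD) (hI := hI) (h₁ := h₁) (h₃ := h₃) (hA := hA) hU7 V h h4 Φ iso U hμ hw Car hΦμ Dμ
  obtain ⟨Mb, jHb, hjHbinj, hjHb, hpiecesb⟩ :=
    iota1Socket_phiMu (hHD := hHD) (hI := hI) (h₁ := h₁) (h₃ := h₃) (hA := hA) hU7 V h h4 Φ iso U hμ hw Car hΦμ Dμ hinst J₁ hΓ₁
  refine false_of_twoSockets (hHD := hHD) (hI := hI) (h₁ := h₁) (h₃ := h₃) (hA := hA) V h Φ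
    (Model.sec42DataOf h iso (pkgF L) ι₁ (pkgV V) Φ) _ M Mb jH jHb hjHinj hjHbinj hjH hjHb
    (HodgeCM.Level.capThree (V := V) ((Model.sec42DataOf h iso (pkgF L) ι₁ (pkgV V) Φ).S.K₀.1 : Subgroup ↥V.adelicFin) (Model.sec42DataOf h iso (pkgF L) ι₁ (pkgV V) Φ).S.K₀.2.1)
    (HodgeCM.Level.belowConjThree_capThree _ _) _ _ hpieces hpiecesb (fun K => ?_) (fun K => ?_) (fun f => ?_) hss hmf hPN
  · -- pin at `ῑ₁`: records admissible for `Φ_μ ∋ ι₁` through `ῑ₁` carry (0,1)-classes (the audit's parity statement)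
    exact cmClasses_subset_hodge_piece_zero_one (LiuDictionary.ofTower hHD hI h₁ h₃ hA V Unit (fun _ => Unit) (fun _ _ => PUnit) (fun _ => True)
            (fun _ d => d.IsReflexOfTypeG ((starRingEnd ℂ).comp ι₁) hμ.cmType)) K ()
      (fun d hd => tau_notMem_cmType_of_isReflexOfType_starRingEnd_comp ι₁ d _ (hd inferInstance) hΦμ)
  · -- `J₁` at `ι₁`: records admissible for `Φ_μ ∋ ι₁` through `ι₁` carry (1,0)-classes
    exact cmClasses_subset_hodge_piece_one_zero (LiuDictionary.ofTower hHD hI h₁ h₃ hA V Unit (fun _ => Unit) (fun _ _ => PUnit) (fun _ => True)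
            (fun _ d => d.IsReflexOfTypeG ι₁ hμ.cmType)) K ()
      (fun d hd => tau_mem_cmType_of_isReflexOfType ι₁ d _ (hd inferInstance) hΦμ)
  · -- every `f ∈ Ω(μ)` comes from all deep levels (`Dμ` is the one object for both records)
    obtain ⟨K, hK, hφ⟩ := exists_level_forall_res_eq V h Φ iso U hμ hw Car _ Dμ f
    exact ⟨K, hK, fun Γ hle => ⟨hφ Γ hle, hφ Γ hle⟩⟩

end HeadPhiMu

end Summit.HodgeConjecture.CorCM.D2Bridge.NotHJ

end
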